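import Mathlib
import Literature.Analysis.FluidPDE.Tao2016AveragedNS.ShiftSetCascadeFlows
import Summits.NavierStokesRegularity.NavierStokesRegularity.Theorems.TaoLadderRungTwoFlatMirrorTableDefs
import Summits.NavierStokesRegularity.NavierStokesRegularity.Theorems.TaoLadderRungTwoFlatGaugeCaptureDefs
import HarnessLib

/-! ## NUM-T51 / TRAP #5 (theory-1 g39): the ANCHORED one-hop contraction — the clause the hop-invariant `H(n)` consumes

MODEL lattice only (mirror table `mirrorTable ε ε` on `shiftSetFlat`, `m = 2`); nothing here is about the Navier–Stokes
equations. Cell file harvest-h2-tao-ladder-theory-1/numT51/AnchoredContraction51.lean (sha16 ea2da9325bafc264), `MirrorPulse`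
section landed verbatim by p1 g21 as `…Theorems.TaoLadderRungTwoFlatAnchoredContractionDefs` (STEP 0 of LADDER §51.5; the
`Split51` re-split texts and glue stay in the cell file until the route is re-split); kernel-checked, 0 sorry.

THE DEFECT (AUDIT-51 §1). Child 1 of SPLIT-T48 (`MirrorSolitaryWave`, stmt-…-23908) exports, and child 2 (`GradedAdiabaticWake`,
stmt-…-23909) consumes, `MirrorPulse.HopContractionWith ε τ Φ ω ρ C N`: after `N` hops there EXIST neutral coefficients
`c₁, c₂` (phase, scale) with `‖shift u(Nτ) − c₁Φ̇ − c₂Φ‖_ω ≤ ρ‖u(0)‖_ω`. The hop-invariant frame (numT50/HopInvariant50.lean)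
runs a ONE-hop induction whose `CoreClause` measures the deviation from the SCALED reference `anchorScale(z)·u⋆`, i.e. with the
scale coefficient FORCED by the anchor coordinate `(i₀, 0)` (the corrected deviation vanishes there); the phase coefficient is
realised by the section-time rule `τ₁` and may stay free. From the typed clause one recovers the anchored bound only with the
loss factor `‖P_a‖_ω = 1 + q`, `q = sup_{(i,k) ≠ (i₀,0)} ω_{ik}|Φ_{i,k+1}(τ)| / (ω_{i₀0}|Φ_{i₀,1}(τ)|)` (theorem
`anchoredHopContraction_of_hopContractionWith_one` below — and the factor is sharp in general), and for `N ≥ 2` nothing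
one-hop at all. Float (NUM-T51, E-T46-hop's fixed point): `q = 0.382` in every species-uniform `geomGauge g b`; anchored
one-hop factor `0.609` at `(4,2)`, transport floor `1/b` for ANY choice of `c₁, c₂`.

THE REPAIR typed here: `MirrorPulse.AnchoredHopContraction ε τ Φ ω i₀ ρ C` (one hop; `c₂ := anchorCoeff` forced so that the
corrected deviation VANISHES at the anchor coordinate; `c₁` free with `|c₁| ≤ C·B`; `|c₂| ≤ C·B` recorded), the bridge
`AnchoredHopContraction … → HopContractionWith … ρ C 1` (the re-typed child 1 REFINES the filed one), the converse-with-loss,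
and the re-split texts `MirrorSolitaryWaveA → GradedAdiabaticWakeA → FlatGapCertificatesV2` with their 12-line glue. -/

-- the sub-problem namespace repeats the summit name by design (D-0017)
set_option linter.dupNamespace false

noncomputable section

namespace Summit.NavierStokesRegularity.NavierStokesRegularity.Theorems

open Set Filter Literature.Analysis.FluidPDE Literature.Analysis.FluidPDE.TaoCascade
open scoped Topology

namespace MirrorPulse

/-- The ANCHOR (scale) coefficient forced by the observable coordinate: the unique `c₂` for which the corrected one-hop
deviation `u(τ) − c₁Φ̇(τ) − c₂Φ(τ)` vanishes at `(i₀, 1)` (shell `0` after re-centring).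
[cite: Tao2016AveragedNS, §6.3–6.4 (statement shape); cell LADDER §51 (TRAP #5)] -/
def anchorCoeff (ε τ : ℝ) (Φ : Fin 2 → ℤ → ℝ → ℝ) (i₀ : Fin 2) (u : Fin 2 → ℤ → ℝ → ℝ) (c₁ : ℝ) : ℝ :=
  (u i₀ 1 τ - c₁ * quadTermOn shiftSetFlat 0 (mirrorTable ε ε) Φ i₀ 1 τ) / Φ i₀ 1 τ

/-- The anchored correction kills the anchor coordinate. [cite: Tao2016AveragedNS, §6.3–6.4; cell LADDER §51] -/
theorem anchorCoeff_spec {ε τ : ℝ} {Φ : Fin 2 → ℤ → ℝ → ℝ} {i₀ : Fin 2} (hΦ : Φ i₀ 1 τ ≠ 0)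
    (u : Fin 2 → ℤ → ℝ → ℝ) (c₁ : ℝ) :
    u i₀ 1 τ - c₁ * quadTermOn shiftSetFlat 0 (mirrorTable ε ε) Φ i₀ 1 τ
      - anchorCoeff ε τ Φ i₀ u c₁ * Φ i₀ 1 τ = 0 := by
  unfold anchorCoeff
  field_simp
  ring

/-- **(S2-anchored) THE ANCHORED ONE-HOP CONTRACTION** in the gauge `ω`, observable species `i₀`: for every variational
solution `u` along `Φ` on `[0, τ]` with `ω·|u(0)| ≤ B` there is a PHASE coefficient `c₁` (`|c₁| ≤ C·B`) such that, with the
SCALE coefficient `c₂ := anchorCoeff` FORCED by the anchor coordinate (`|c₂| ≤ C·B` recorded), the corrected deviation one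
shell up at time `τ` is within `ρ·B` in the gauge. This is the induced-norm statement E-T46-hop measured (`P :=` kill the scale
direction through the observed coordinate; float `0.544` at `(g,b) = (4,2)` half-offset, `0.609` species-uniform) and the
one the hop invariant's `CoreClause` consumes per hop. A predicate; nothing asserted.
[cite: Tao2016AveragedNS, §6.3–6.4 (statement shape of a contraction certificate); cell LADDER §46.10 (E-T46-hop), §51] -/
def AnchoredHopContraction (ε τ : ℝ) (Φ : Fin 2 → ℤ → ℝ → ℝ) (ω : Fin 2 → ℤ → ℝ) (i₀ : Fin 2) (ρ C : ℝ) :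
    Prop :=
  (∀ i k, 0 < ω i k) ∧ 0 ≤ ρ ∧ ρ < 1 ∧ 0 ≤ C ∧ Φ i₀ 1 τ ≠ 0 ∧
    ∀ (u : Fin 2 → ℤ → ℝ → ℝ) (B : ℝ), IsVariationalOn ε τ Φ u →
      (∀ i k, ω i k * |u i k 0| ≤ B) →
        ∃ c₁ : ℝ, |c₁| ≤ C * B ∧ |anchorCoeff ε τ Φ i₀ u c₁| ≤ C * B ∧
          ∀ (i : Fin 2) (k : ℤ),
            ω i k * |u i (k + 1) τ
              - c₁ * quadTermOn shiftSetFlat 0 (mirrorTable ε ε) Φ i (k + 1) τ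
              - anchorCoeff ε τ Φ i₀ u c₁ * Φ i (k + 1) τ| ≤ ρ * B

/-- **BRIDGE (the re-typed child 1 refines the filed one).** The anchored one-hop contraction implies
`HopContractionWith … ρ C 1` (take `c₂ := anchorCoeff`). [cite: Tao2016AveragedNS, §6.3–6.4; cell LADDER §51] -/
theorem AnchoredHopContraction.hopContractionWith {ε τ : ℝ} {Φ : Fin 2 → ℤ → ℝ → ℝ} {ω : Fin 2 → ℤ → ℝ}
    {i₀ : Fin 2} {ρ C : ℝ} (h : AnchoredHopContraction ε τ Φ ω i₀ ρ C) :
    HopContractionWith ε τ Φ ω ρ C 1 := by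
  obtain ⟨hω, hρ0, hρ1, hC, -, h⟩ := h
  refine ⟨hω, hρ0, hρ1, hC, le_rfl, ?_⟩
  intro u B hvar hB
  have hvar' : IsVariationalOn ε τ Φ u := by simpa using hvar
  obtain ⟨c₁, hc₁, hc₂, hk⟩ := h u B hvar' hB
  refine ⟨c₁, anchorCoeff ε τ Φ i₀ u c₁, hc₁, hc₂, ?_⟩
  intro i k
  simpa using hk i k

/-- **CONVERSE WITH LOSS (what the filed clause yields for the frame).** From the one-hop typed clause
`HopContractionWith … ρ C 1` and a PROFILE BOUND `ω_{ik}|Φ_{i,k+1}(τ)| ≤ q·ω_{i₀0}|Φ_{i₀,1}(τ)|` off the anchor coordinate,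
the anchored contraction holds with factor `(1+q)·ρ` — provided `(1+q)ρ < 1`. (Re-anchoring the certificate's `c₂` moves the
corrected deviation by `(w_{i₀0}/Φ_{i₀1})·Φ`, whose gauge norm is `≤ q·ρB`.) For `N ≥ 2` hops there is no such lemma.
[cite: Tao2016AveragedNS, §6.3–6.4; cell LADDER §51 (TRAP #5: loss factor `1+q = 1.382`, float)] -/
theorem anchoredHopContraction_of_hopContractionWith_one {ε τ : ℝ} {Φ : Fin 2 → ℤ → ℝ → ℝ}
    {ω : Fin 2 → ℤ → ℝ} {i₀ : Fin 2} {ρ C q : ℝ} (h : HopContractionWith ε τ Φ ω ρ C 1)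
    (hΦ : Φ i₀ 1 τ ≠ 0) (hq : 0 ≤ q)
    (hprof : ∀ (i : Fin 2) (k : ℤ), ¬(i = i₀ ∧ k = 0) →
      ω i k * |Φ i (k + 1) τ| ≤ q * (ω i₀ 0 * |Φ i₀ 1 τ|))
    (hρ : (1 + q) * ρ < 1) :
    AnchoredHopContraction ε τ Φ ω i₀ ((1 + q) * ρ) (C + 1 / (ω i₀ 0 * |Φ i₀ 1 τ|)) := by
  obtain ⟨hω, hρ0, hρ1, hC, -, h⟩ := h
  have hω0 : 0 < ω i₀ 0 := hω i₀ 0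
  have hΦ0 : 0 < |Φ i₀ 1 τ| := abs_pos.mpr hΦ
  have hA : 0 < ω i₀ 0 * |Φ i₀ 1 τ| := mul_pos hω0 hΦ0
  refine ⟨hω, mul_nonneg (by linarith) hρ0, hρ, add_nonneg hC (one_div_pos.mpr hA).le, hΦ, ?_⟩
  intro u B hvar hB
  have hvar1 : IsVariationalOn ε ((1 : ℕ) * τ) Φ u := by simpa using hvar
  obtain ⟨c₁, c₂, hc₁, hc₂, hk⟩ := h u B hvar1 hB
  -- the typed clause at `N = 1`, de-sugared
  have hk' : ∀ (i : Fin 2) (k : ℤ), ω i k * |u i (k + 1) τ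
      - c₁ * quadTermOn shiftSetFlat 0 (mirrorTable ε ε) Φ i (k + 1) τ - c₂ * Φ i (k + 1) τ| ≤ ρ * B := by
    intro i k
    simpa using hk i k
  have hB0 : 0 ≤ B := le_trans (mul_nonneg (hω i₀ 0).le (abs_nonneg _)) (hB i₀ 0)
  -- the anchor residual of the certificate's correction
  set wa : ℝ := u i₀ 1 τ - c₁ * quadTermOn shiftSetFlat 0 (mirrorTable ε ε) Φ i₀ 1 τ - c₂ * Φ i₀ 1 τ
    with hwa
  have hwa_bd : ω i₀ 0 * |wa| ≤ ρ * B := by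
    have := hk' i₀ 0
    simpa [hwa] using this
  -- re-anchoring shifts `c₂` by `wa / Φ i₀ 1 τ`
  have hD : anchorCoeff ε τ Φ i₀ u c₁ = c₂ + wa / Φ i₀ 1 τ := by
    simp only [anchorCoeff, hwa]
    field_simp
    ring
  have hextra : 0 ≤ 1 / (ω i₀ 0 * |Φ i₀ 1 τ|) * B := mul_nonneg (one_div_pos.mpr hA).le hB0
  refine ⟨c₁, ?_, ?_, ?_⟩
  · -- `|c₁| ≤ C·B ≤ (C + 1/(ω|Φ|))·B`
    calc |c₁| ≤ C * B := hc₁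
      _ ≤ C * B + 1 / (ω i₀ 0 * |Φ i₀ 1 τ|) * B := le_add_of_nonneg_right hextra
      _ = (C + 1 / (ω i₀ 0 * |Φ i₀ 1 τ|)) * B := by ring
  · -- `|c₂^a| ≤ (C + 1/(ω|Φ|))·B`
    have h1 : |wa| ≤ B / ω i₀ 0 := by
      rw [le_div_iff₀ hω0]
      calc |wa| * ω i₀ 0 = ω i₀ 0 * |wa| := mul_comm _ _
        _ ≤ ρ * B := hwa_bd
        _ ≤ 1 * B := by gcongr
        _ = B := one_mul B
    have h2 : |wa / Φ i₀ 1 τ| ≤ 1 / (ω i₀ 0 * |Φ i₀ 1 τ|) * B := by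
      rw [abs_div, div_le_iff₀ hΦ0]
      calc |wa| ≤ B / ω i₀ 0 := h1
        _ = 1 / (ω i₀ 0 * |Φ i₀ 1 τ|) * B * |Φ i₀ 1 τ| := by field_simp
    calc |anchorCoeff ε τ Φ i₀ u c₁| = |c₂ + wa / Φ i₀ 1 τ| := by rw [hD]
      _ ≤ |c₂| + |wa / Φ i₀ 1 τ| := abs_add_le _ _
      _ ≤ C * B + 1 / (ω i₀ 0 * |Φ i₀ 1 τ|) * B := add_le_add hc₂ h2
      _ = (C + 1 / (ω i₀ 0 * |Φ i₀ 1 τ|)) * B := by ring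
  · intro i k
    by_cases hik : i = i₀ ∧ k = 0
    · -- the anchor coordinate itself: the corrected deviation vanishes there
      obtain ⟨rfl, rfl⟩ := hik
      have h0 := anchorCoeff_spec (ε := ε) hΦ u c₁
      have : u i (0 + 1) τ - c₁ * quadTermOn shiftSetFlat 0 (mirrorTable ε ε) Φ i (0 + 1) τ
          - anchorCoeff ε τ Φ i u c₁ * Φ i (0 + 1) τ = 0 := by simpa using h0
      rw [this, abs_zero, mul_zero]
      exact mul_nonneg (mul_nonneg (by linarith) hρ0) hB0
    · -- a general coordinate: triangle inequality + the profile bound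
      have hp := hprof i k hik
      set wik : ℝ := u i (k + 1) τ - c₁ * quadTermOn shiftSetFlat 0 (mirrorTable ε ε) Φ i (k + 1) τ
        - c₂ * Φ i (k + 1) τ with hwik
      have hwik_bd : ω i k * |wik| ≤ ρ * B := by simpa [hwik] using hk' i k
      have hexpr : u i (k + 1) τ - c₁ * quadTermOn shiftSetFlat 0 (mirrorTable ε ε) Φ i (k + 1) τ
          - anchorCoeff ε τ Φ i₀ u c₁ * Φ i (k + 1) τ = wik - wa / Φ i₀ 1 τ * Φ i (k + 1) τ := by
        rw [hD, hwik]; ring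
      rw [hexpr]
      have hωk : 0 ≤ ω i k := (hω i k).le
      have hnn : 0 ≤ |wa| / |Φ i₀ 1 τ| := div_nonneg (abs_nonneg _) hΦ0.le
      calc ω i k * |wik - wa / Φ i₀ 1 τ * Φ i (k + 1) τ|
          ≤ ω i k * (|wik| + |wa / Φ i₀ 1 τ * Φ i (k + 1) τ|) := by
            gcongr
            exact abs_sub _ _
        _ = ω i k * |wik| + |wa| / |Φ i₀ 1 τ| * (ω i k * |Φ i (k + 1) τ|) := by
            rw [abs_mul, abs_div]; ring
        _ ≤ ρ * B + |wa| / |Φ i₀ 1 τ| * (q * (ω i₀ 0 * |Φ i₀ 1 τ|)) := by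
            gcongr
        _ = ρ * B + q * (ω i₀ 0 * |wa|) := by
            field_simp
        _ ≤ ρ * B + q * (ρ * B) := by gcongr
        _ = (1 + q) * ρ * B := by ring

end MirrorPulse

end Summit.NavierStokesRegularity.NavierStokesRegularity.Theorems

end
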